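import Literature.NumberTheory.EllipticCurves.ManinConstantArbitraryParametrizationIntegralProofs
import Summits.ABC.ABC.Theses.IsogenyGlueCongruence
import Summits.ABC.ABC.Theses.RibetTakahashiSplit
import Summits.ABC.ABC.Theorems.IsogenyGlueCongruenceMazurKenkuBoundOfRadius
import Summits.ABC.ABC.Theorems.IsogenyGlueCongruenceKenkuPrintedLevelsOfThreeLevels
import HarnessLib

/-!
# StubIdeasK1G11Doors — gen-11 sanity (planner stub-ideation k1, crux stmt-ABC-11338)

The four IMPORT doors for `stub_pasten163 : PastenShimura2024_minimalDegree_le_163_mul`,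
elaborated against today's tree (companion of `STUB-IDEAS-stub_pasten163-1.md` §1). No `sorry`.
-/

set_option linter.dupNamespace false

open Literature.NumberTheory.EllipticCurves Literature.NumberTheory.EllipticCurves.ModularForms

namespace Summit.ABC.ABC.Cruxes.DefiniteRTControlPrime.StubIdeasK1G11

/-- Door 1: the cite-only Literature fact (Mazur 1978 Thm 1 + Kenku 1982, AEC IX.6 Ex. 6.4). -/
theorem stub_pasten163_of_mazurKenku (hMK : mazurKenku_exists_cyclic_isogeny) :
    PastenShimura2024_minimalDegree_le_163_mul :=
  PastenShimura2024_minimalDegree_le_163_mul_of_mazurKenku' hMK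

/-- Door 2: the route item `MazurKenkuBound` (stmt-ABC-15125) — definitionally the stub. -/
theorem stub_pasten163_of_item15125
    (h : Summit.ABC.ABC.Theses.IsogenyGlueCongruence.MazurKenkuBound) :
    PastenShimura2024_minimalDegree_le_163_mul := h

/-- Door 3: the radius item `MazurKenkuRadius` (stmt-ABC-15193). -/
theorem stub_pasten163_of_item15193
    (hRad : Summit.ABC.ABC.Theses.RibetTakahashiSplit.MazurKenkuRadius) :
    PastenShimura2024_minimalDegree_le_163_mul :=
  Summit.ABC.ABC.Theorems.mazurKenkuBound_of_radiusItem hRad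

/-- Door 4: the in-tree Kenku road — residual inputs Cor 4.4 (stmt-ABC-18223), KF13 (cite-only),
seven prime j-tables, three levels {65,125,169}. -/
theorem stub_pasten163_of_kenkuRoad
    (h44 : Summit.ABC.ABC.Theses.IsogenyGlueCongruence.MazurCor44)
    (h13 : kleinFrickeThirteen_exists_j_eq)
    (hT7 : ∀ (V V' : WeierstrassCurve ℚ) [V.IsElliptic] [V'.IsElliptic] (ψ : WeierstrassCurve.Isogeny V V'),
      ψ.IsCyclic → ψ.degree ∈ ({11, 17, 19, 37, 43, 67, 163} : Finset ℕ) →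
        (ψ.degree, V.j) ∈ ({((11 : ℕ), (-32768 : ℚ)), (11, -121), (11, -24729001),
          (17, -297756989 / 2), (17, -882216989 / 131072), (19, -884736), (37, -9317),
          (37, -162677523113838677), (43, -884736000), (67, -147197952000),
          (163, -262537412640768000)} : Finset (ℕ × ℚ)))
    (hL3 : ∀ (V V' : WeierstrassCurve ℚ) [V.IsElliptic] [V'.IsElliptic] (ψ : WeierstrassCurve.Isogeny V V'),
      ψ.IsCyclic → ψ.degree ∉ ({65, 125, 169} : Finset ℕ)) :
    PastenShimura2024_minimalDegree_le_163_mul :=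
  Summit.ABC.ABC.Theorems.mazurKenkuBound_of_cor44_of_kleinFricke13_of_primeTables_of_threeLevels
    h44 h13 hT7 hL3

/-- Converse bookkeeping: the stub IS item 15125 (so closing either closes both). -/
theorem item15125_iff_stub :
    Summit.ABC.ABC.Theses.IsogenyGlueCongruence.MazurKenkuBound ↔
      PastenShimura2024_minimalDegree_le_163_mul := Iff.rfl

end Summit.ABC.ABC.Cruxes.DefiniteRTControlPrime.StubIdeasK1G11
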